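import Mathlib
import Summits.MatrixMultiplication.MatrixMultiplication.Theses.SnSubsetDichotomy
import Summits.MatrixMultiplication.MatrixMultiplication.Theorems.SnSubsetDichotomyJuntaBranchStubRegularity

/-!
# The sliced shadow of `JuntaBranch` — an `ε`-free, bump-free necessary condition
(crux stmt-MatrixMultiplication-8304, line `envelope-stability`, "sliced maximiser" test)

SLICING. In any TPP triple `(S,T,U)` of `S_n` replace `S` by its heaviest point atom
`S_{i→0} = {σ ∈ S | σ i = 0}` (`|S| ≤ n·|S_{i→0}|`, `JuntaBranch.exists_heavy_atom`). The slice is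
TPP (heredity), loses at most a factor `n` of volume — so `Large(c')` at level `n` becomes
`Large(c)` for every `c > c'` once `e^{(c-c')√n} ≥ n` — and is MAXIMALLY bumpy at level `1`: all of
`S_{i→0}` lies in the umvirate `U_{i→0}`, ratio `n > n^{3/4}`. Feeding the slice to
`JuntaBranch (ε := 1/4)` gives:

`juntaBranch_imp_slicedShadow : JuntaBranch → ∀ c > 0, ∀ c' < c, ∃ n₀, ∀ n ≥ n₀, ∀ TPP (S,T,U) ⊆ S_n,
  (n!)^{3/2} e^{-c'√n} ≤ |S||T||U| → ∃ n' ∈ [n − √n, n), ∃ TPP (S',T',U') ⊆ S_{n'},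
  e^{c+1}·|S||T||U|·(n'!/n!)^{3/2} ≤ n·|S'||T'||U'|`.

So every proof of the crux proves this SHADOW, which mentions neither `ε` nor any bump: "below
every near-threshold TPP triple there is, inside the window, a TPP triple within the factor
`n·e^{-(c+1)}` of its normalised volume". Together with the standing disprover's
`withoutBump_iff_superDecay` (the crux with the bump hypothesis deleted and the FULL gain `e^{c+1}`
is equivalent to SuperDecay) this sandwiches the crux between two bump-free envelope statements
that differ by the factor `n` in the gain (and `c'` versus `c`): the bump hypothesis of the crux is
worth at most a factor `n`. On level-1-flat knife-edge triples (subsets of three matching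
centralisers, route crux `HyperoctahedralSubsets`) no common-target descent at any level supplies
even the shadow's gain (`R_S R_T R_U ≤ n` at level `2`, `= 1` at level `1`), so there the shadow —
hence the crux — needs a non-descent source of better triples in the window, or the non-existence
of such Large triples (a GlobalBranch/HyperoctahedralSubsets-type theorem). Def-free statement.
-/

set_option linter.dupNamespace false

open Literature.Combinatorics.Additive
open Summit.MatrixMultiplication.MatrixMultiplication.Theses.SnSubsetDichotomy
open scoped Classical

namespace Summit.MatrixMultiplication.MatrixMultiplication.Theorems.JuntaBranch

/-- Slack absorbs a factor `n`: for `c' < c` and `n ≥ ⌈24/(c-c')^4⌉₊`,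
`n · e^{-c√n} ≤ e^{-c'√n}` (from `e^{x} ≥ x^4/4!`). -/
theorem nat_mul_exp_le_exp_of_lt {c c' : ℝ} (hc' : c' < c) :
    ∃ nT : ℕ, ∀ n ≥ nT, (n : ℝ) * Real.exp (-(c * Real.sqrt (n : ℝ))) ≤
      Real.exp (-(c' * Real.sqrt (n : ℝ))) := by
  set δ : ℝ := c - c' with hδ
  have hδ0 : 0 < δ := by rw [hδ]; linarith
  refine ⟨⌈24 / δ ^ 4⌉₊, fun n hn => ?_⟩
  have hnδ : 24 / δ ^ 4 ≤ (n : ℝ) := le_trans (Nat.le_ceil _) (by exact_mod_cast hn)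
  have hn0 : (0 : ℝ) ≤ n := Nat.cast_nonneg n
  have hs0 : 0 ≤ Real.sqrt (n : ℝ) := Real.sqrt_nonneg _
  have h4 := Real.pow_div_factorial_le_exp (δ * Real.sqrt (n : ℝ)) (mul_nonneg hδ0.le hs0) 4
  have hsq : Real.sqrt (n : ℝ) ^ 4 = (n : ℝ) ^ 2 := by
    rw [show (4 : ℕ) = 2 * 2 by norm_num, pow_mul, Real.sq_sqrt hn0]
  have h4' : δ ^ 4 * (n : ℝ) ^ 2 / 24 ≤ Real.exp (δ * Real.sqrt (n : ℝ)) := by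
    have e : (δ * Real.sqrt (n : ℝ)) ^ 4 / (Nat.factorial 4 : ℝ) = δ ^ 4 * (n : ℝ) ^ 2 / 24 := by
      rw [mul_pow, hsq]
      norm_num [Nat.factorial]
    rw [← e]
    exact h4
  have hδ4 : 0 < δ ^ 4 := by positivity
  have hkey : (n : ℝ) ≤ δ ^ 4 * (n : ℝ) ^ 2 / 24 := by
    have h1 : 24 ≤ δ ^ 4 * (n : ℝ) := by
      have := (div_le_iff₀ hδ4).mp hnδ
      linarith
    nlinarith
  have hE : Real.exp (-(c' * Real.sqrt (n : ℝ))) =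
      Real.exp (δ * Real.sqrt (n : ℝ)) * Real.exp (-(c * Real.sqrt (n : ℝ))) := by
    rw [← Real.exp_add, hδ]
    ring_nf
  rw [hE]
  exact mul_le_mul_of_nonneg_right (hkey.trans h4') (Real.exp_pos _).le

/-- **The sliced shadow of the crux.** `JuntaBranch` implies the following `ε`-free, bump-free
statement: for all `c > 0` and `c' < c`, eventually every TPP triple `(S,T,U)` of `S_n` with
`(n!)^{3/2} e^{-c'√n} ≤ |S||T||U|` has, at some level `n' ∈ [n − √n, n)`, a TPP triple
`(S',T',U')` of `S_{n'}` with `e^{c+1}·|S||T||U|·(n'!/n!)^{3/2} ≤ n·|S'||T'||U'|`.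
Proof: slice `S` to its heaviest point atom at the target `0` (`exists_heavy_atom`: a factor `≤ n`
of volume, absorbed by `nat_mul_exp_le_exp_of_lt`), which is `1/4`-super-neutral at level `1`
(ratio `n > n^{3/4}` for `n ≥ 2`), and apply `JuntaBranch` with `ε := 1/4` to the sliced triple. -/
theorem juntaBranch_imp_slicedShadow :
    JuntaBranch → ∀ c : ℝ, 0 < c → ∀ c' : ℝ, c' < c → ∃ n₀ : ℕ, ∀ n ≥ n₀,
      ∀ S T U : Finset (Equiv.Perm (Fin n)), TripleProductProperty S T U →
      (n.factorial : ℝ) ^ ((3 : ℝ) / 2) * Real.exp (-(c' * Real.sqrt (n : ℝ))) ≤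
        ((S.card * T.card * U.card : ℕ) : ℝ) →
      ∃ n' : ℕ, (n : ℝ) - Real.sqrt (n : ℝ) ≤ (n' : ℝ) ∧ n' < n ∧
        ∃ S' T' U' : Finset (Equiv.Perm (Fin n')), TripleProductProperty S' T' U' ∧
          Real.exp (c + 1) * ((S.card * T.card * U.card : ℕ) : ℝ) *
              ((n'.factorial : ℝ) / (n.factorial : ℝ)) ^ ((3 : ℝ) / 2) ≤
            (n : ℝ) * ((S'.card * T'.card * U'.card : ℕ) : ℝ) := by
  intro hJB c hc c' hc'
  obtain ⟨n₂, hJ⟩ := hJB (1 / 4) (by norm_num) c hc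
  obtain ⟨nT, hT⟩ := nat_mul_exp_le_exp_of_lt hc'
  refine ⟨max n₂ (max nT 2), fun n hn S T U hTPP hLarge => ?_⟩
  have hn₂ : n₂ ≤ n := le_of_max_le_left hn
  have hnT : nT ≤ n := le_of_max_le_left (le_of_max_le_right hn)
  have hn2 : 2 ≤ n := le_of_max_le_right (le_of_max_le_right hn)
  have hn1 : 1 ≤ n := le_trans (by norm_num) hn2
  -- the heaviest point atom of S at the target 0
  set l : Fin n := ⟨0, hn1⟩ with hl
  obtain ⟨i, hi⟩ := exists_heavy_atom l S
  set X : Finset (Equiv.Perm (Fin n)) := S.filter (fun σ => σ i = l) with hX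
  have hXS : X ⊆ S := Finset.filter_subset _ _
  have hTPPX : TripleProductProperty X T U := hTPP.mono hXS subset_rfl subset_rfl
  -- volumes
  have hV0 : (0 : ℝ) < ((S.card * T.card * U.card : ℕ) : ℝ) := lt_of_lt_of_le (by positivity) hLarge
  have hV0' : 0 < S.card * T.card * U.card := by exact_mod_cast hV0
  have hSpos : 0 < S.card := by
    rcases Nat.eq_zero_or_pos S.card with h0 | h0
    · rw [h0] at hV0'; simp at hV0'
    · exact h0
  have hXpos : 0 < X.card := Nat.pos_of_mul_pos_left (lt_of_lt_of_le hSpos hi)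
  have hVX : ((S.card * T.card * U.card : ℕ) : ℝ) ≤ (n : ℝ) * ((X.card * T.card * U.card : ℕ) : ℝ) := by
    have h1 : S.card * T.card * U.card ≤ n * (X.card * T.card * U.card) := by
      calc S.card * T.card * U.card ≤ (n * X.card) * T.card * U.card :=
            Nat.mul_le_mul (Nat.mul_le_mul hi le_rfl) le_rfl
        _ = n * (X.card * T.card * U.card) := by ring
    exact_mod_cast h1
  -- Large(c) for the slice
  have hLargeX : (n.factorial : ℝ) ^ ((3 : ℝ) / 2) * Real.exp (-(c * Real.sqrt (n : ℝ))) ≤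
      ((X.card * T.card * U.card : ℕ) : ℝ) := by
    have hn0 : (0 : ℝ) < n := by exact_mod_cast (lt_of_lt_of_le (by norm_num) hn1)
    have hF0 : 0 ≤ (n.factorial : ℝ) ^ ((3 : ℝ) / 2) := by positivity
    have h1 := hT n hnT
    -- n * ((n!)^{3/2} e^{-c√n}) ≤ (n!)^{3/2} e^{-c'√n} ≤ V ≤ n * V_X
    have h2 : (n : ℝ) * ((n.factorial : ℝ) ^ ((3 : ℝ) / 2) * Real.exp (-(c * Real.sqrt (n : ℝ)))) ≤
        (n : ℝ) * ((X.card * T.card * U.card : ℕ) : ℝ) := by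
      calc (n : ℝ) * ((n.factorial : ℝ) ^ ((3 : ℝ) / 2) * Real.exp (-(c * Real.sqrt (n : ℝ))))
          = (n.factorial : ℝ) ^ ((3 : ℝ) / 2) * ((n : ℝ) * Real.exp (-(c * Real.sqrt (n : ℝ)))) := by
            ring
        _ ≤ (n.factorial : ℝ) ^ ((3 : ℝ) / 2) * Real.exp (-(c' * Real.sqrt (n : ℝ))) :=
            mul_le_mul_of_nonneg_left h1 hF0
        _ ≤ ((S.card * T.card * U.card : ℕ) : ℝ) := hLarge
        _ ≤ (n : ℝ) * ((X.card * T.card * U.card : ℕ) : ℝ) := hVX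
    exact le_of_mul_le_mul_left h2 hn0
  -- the slice is 1/4-super-neutral at level 1 (all of X maps i ↦ l)
  have hbump : ∃ Y : Finset (Equiv.Perm (Fin n)), (Y = X ∨ Y = T ∨ Y = U) ∧
      ∃ t : ℕ, 1 ≤ t ∧ (t : ℝ) ≤ Real.sqrt (n : ℝ) ∧ ∃ I L : Fin t → Fin n,
        Function.Injective I ∧ Function.Injective L ∧
        (n : ℝ) ^ ((1 / 2 + (1 / 4 : ℝ)) * t) * (Y.card : ℝ) <
          ((Y.filter (fun σ => ∀ k, σ (I k) = L k)).card : ℝ) * (n.descFactorial t : ℝ) := by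
    refine ⟨X, Or.inl rfl, 1, le_rfl, ?_, fun _ => i, fun _ => l,
      Function.injective_of_subsingleton _, Function.injective_of_subsingleton _, ?_⟩
    · rw [Nat.cast_one, Real.le_sqrt (by norm_num) (Nat.cast_nonneg n)]
      have : (1 : ℝ) ≤ n := by exact_mod_cast hn1
      linarith
    · have hfilt : X.filter (fun σ => ∀ _k : Fin 1, σ i = l) = X := by
        apply Finset.filter_true_of_mem
        intro σ hσ _
        rw [hX, Finset.mem_filter] at hσ
        exact hσ.2
      rw [hfilt, Nat.descFactorial_one, Nat.cast_one, mul_one]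
      have hXR : (0 : ℝ) < X.card := by exact_mod_cast hXpos
      have hn2R : (2 : ℝ) ≤ n := by exact_mod_cast hn2
      have hpow : (n : ℝ) ^ ((1 / 2 + (1 / 4 : ℝ)) * (1 : ℝ)) < (n : ℝ) := by
        have h1 : (n : ℝ) ^ ((1 / 2 + (1 / 4 : ℝ)) * (1 : ℝ)) < (n : ℝ) ^ (1 : ℝ) :=
          Real.rpow_lt_rpow_of_exponent_lt (by linarith) (by norm_num)
        rwa [Real.rpow_one] at h1
      nlinarith
  -- apply the crux to the slice and undo the slicing loss
  obtain ⟨n', h1, h2, S', T', U', hTPP', hle⟩ := hJ n hn₂ X T U hTPPX hLargeX hbump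
  refine ⟨n', h1, h2, S', T', U', hTPP', ?_⟩
  have hr : 0 ≤ ((n'.factorial : ℝ) / (n.factorial : ℝ)) ^ ((3 : ℝ) / 2) := by positivity
  have he : 0 ≤ Real.exp (c + 1) := (Real.exp_pos _).le
  have hn0 : (0 : ℝ) ≤ n := Nat.cast_nonneg n
  calc Real.exp (c + 1) * ((S.card * T.card * U.card : ℕ) : ℝ) *
        ((n'.factorial : ℝ) / (n.factorial : ℝ)) ^ ((3 : ℝ) / 2)
      ≤ Real.exp (c + 1) * ((n : ℝ) * ((X.card * T.card * U.card : ℕ) : ℝ)) *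
          ((n'.factorial : ℝ) / (n.factorial : ℝ)) ^ ((3 : ℝ) / 2) :=
        mul_le_mul_of_nonneg_right (mul_le_mul_of_nonneg_left hVX he) hr
    _ = (n : ℝ) * (Real.exp (c + 1) * ((X.card * T.card * U.card : ℕ) : ℝ) *
          ((n'.factorial : ℝ) / (n.factorial : ℝ)) ^ ((3 : ℝ) / 2)) := by ring
    _ ≤ (n : ℝ) * ((S'.card * T'.card * U'.card : ℕ) : ℝ) := mul_le_mul_of_nonneg_left hle hn0

end Summit.MatrixMultiplication.MatrixMultiplication.Theorems.JuntaBranch
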